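import Summits.AtomisticToContinuum.Crystallization.Theorems.GappedShellCensusCleanLimitsHaveWindowsLaminarBox1

/-!
# Laminar clean box, part 2: the three-disc lemma and the sites of a laminar set

Support for the registered stub `laminar_clean_box` (laminar split, line `Sketch`) of the crux
`GappedShellCensus.CleanLimitsHaveWindows` (stmt-AtomisticToContinuum-15932), continuing part 1.
* Hexagonal index combinatorics (`decide`): the hexagon graph on the six short indices `bpHex` is triangle-free
  (`lcb_hex_no_triangle`), and a unit triangle `0, e, e'` has `e + e' ≡ (δ, δ) mod 3`, `δ ∈ {1, 2}`
  (`lcb_hex_pair_mod`; its centroid is a hollow site `μ + (δ/3)(u + v)`, `lcb_centroid_form`).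
* **Three-disc lemma** `lcb_three_disc`: a planar point whose squared distances to the three vertices of a
  near-unit planar triangle lie in a common window of width `≤ (1.02a)² - (0.98a)²` is within `a/5` of the
  centroid, and the window reaches `≥ (0.98a)²/3` (planar Gram identity `lcb_gram_identity` + arithmetic).
* Sites `lcbPt u v w z (m, i, j) = i u + j v + w m + z m • e₃` of a laminar set, horizontal offsets `lcbOff`,
  `dist² = ‖offset‖² + Δz²` (`lcb_distSq`), injectivity, the transfer of the count / gap clause of
  `v₀ + A (range lcbPt)` to indices (`lcb_countI`, `lcb_gapI`), the index shell `lcbS`; heights: consecutive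
  layers are `≥ √(1501/2500) a ≥ 3a/4` apart (`lcb_height_sq_lower`), layers two apart are out of reach (`lcb_far`).
-/

noncomputable section

namespace Summit.AtomisticToContinuum.Crystallization.Theorems.CleanHull

open Literature.MathematicalPhysics.StatisticalMechanics

/-! ## Hexagonal index combinatorics -/

/-- **No triangle of short vectors through a common vertex is a clique of size four**: three distinct short
indices cannot pairwise differ by short indices (the hexagon graph on `bpHex` is triangle-free). [folklore] -/
theorem lcb_hex_no_triangle : ∀ e₁ ∈ bpHex, ∀ e₂ ∈ bpHex, ∀ e₃ ∈ bpHex,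
    e₂ - e₁ ∈ bpHex → e₃ - e₁ ∈ bpHex → e₃ - e₂ ∈ bpHex → False := by
  decide

/-- **Unit triangles and their centroids**: if `0, e, e'` is a triangle of short indices then
`e + e' ≡ (δ, δ) (mod 3)` with `δ ∈ {1, 2}` (up-triangles `{μ, μ + (1,0), μ + (0,1)}` have centroid
`μ + (1/3, 1/3)`, down-triangles centroid `μ + (2/3, 2/3)`). [folklore] -/
theorem lcb_hex_pair_mod : ∀ e ∈ bpHex, ∀ e' ∈ bpHex, e' - e ∈ bpHex →
    (e.1 + e'.1) % 3 = (e.2 + e'.2) % 3 ∧ ((e.1 + e'.1) % 3 = 1 ∨ (e.1 + e'.1) % 3 = 2) := by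
  decide

/-- The centroid of the lattice triangle `λ₁, λ₂, λ₃` in the form `I u + J v + (δ/3)(u + v)`, given
`(λ₂ - λ₁) + (λ₃ - λ₁) = 3 (q₁, q₂) + (δ, δ)` on indices. [folklore] -/
theorem lcb_centroid_form (u v : EuclideanSpace ℝ (Fin 3)) {i₁ j₁ i₂ j₂ i₃ j₃ q₁ q₂ δ : ℤ}
    (h1 : (i₂ - i₁) + (i₃ - i₁) = 3 * q₁ + δ) (h2 : (j₂ - j₁) + (j₃ - j₁) = 3 * q₂ + δ) :
    (1 / 3 : ℝ) • (((i₁ : ℝ) • u + (j₁ : ℝ) • v) + ((i₂ : ℝ) • u + (j₂ : ℝ) • v) +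
        ((i₃ : ℝ) • u + (j₃ : ℝ) • v)) =
      ((i₁ + q₁ : ℤ) : ℝ) • u + ((j₁ + q₂ : ℤ) : ℝ) • v + ((δ : ℝ) / 3) • (u + v) := by
  have h1' : (i₂ : ℝ) + i₃ = 2 * i₁ + 3 * q₁ + δ := by
    exact_mod_cast (by linarith : i₂ + i₃ = 2 * i₁ + 3 * q₁ + δ)
  have h2' : (j₂ : ℝ) + j₃ = 2 * j₁ + 3 * q₂ + δ := by
    exact_mod_cast (by linarith : j₂ + j₃ = 2 * j₁ + 3 * q₂ + δ)
  push_cast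
  match_scalars <;> linarith

/-! ## Three near-equal distances to the vertices of a near-unit triangle -/

/-- `‖p + q + r‖² = 3(‖p‖² + ‖q‖² + ‖r‖²) - (‖p - q‖² + ‖q - r‖² + ‖p - r‖²)`. [folklore] -/
theorem lcb_sum_three_identity (p q r : EuclideanSpace ℝ (Fin 3)) :
    ‖p + q + r‖ ^ 2 = 3 * (‖p‖ ^ 2 + ‖q‖ ^ 2 + ‖r‖ ^ 2) - (‖p - q‖ ^ 2 + ‖q - r‖ ^ 2 + ‖p - r‖ ^ 2) := by
  rw [norm_add_sq_real, norm_add_sq_real, norm_sub_sq_real, norm_sub_sq_real, norm_sub_sq_real,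
    inner_add_left]
  ring

/-- `2⟪p + q + r, q - p⟫ = 3‖q‖² - 3‖p‖² + ‖r - p‖² - ‖r - q‖²`. [folklore] -/
theorem lcb_inner_sum_diff (p q r : EuclideanSpace ℝ (Fin 3)) :
    2 * inner ℝ (p + q + r) (q - p) = 3 * ‖q‖ ^ 2 - 3 * ‖p‖ ^ 2 + ‖r - p‖ ^ 2 - ‖r - q‖ ^ 2 := by
  have e1 := norm_sub_sq_real r q
  have e2 := norm_sub_sq_real r p
  have e3 := real_inner_comm p q
  simp only [inner_add_left, inner_sub_right, real_inner_self_eq_norm_sq] at *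
  linarith

/-- **The planar Gram identity**: for planar `y, e, f`,
`‖y‖² (‖e‖²‖f‖² - ⟪e,f⟫²) = ⟪y,e⟫²‖f‖² + ⟪y,f⟫²‖e‖² - 2⟪y,e⟫⟪y,f⟫⟪e,f⟫` (the `3 × 3` Gram determinant
of three vectors of a plane vanishes). [folklore] -/
theorem lcb_gram_identity {y e f : EuclideanSpace ℝ (Fin 3)} (hy : y 2 = 0) (he : e 2 = 0) (hf : f 2 = 0) :
    ‖y‖ ^ 2 * (‖e‖ ^ 2 * ‖f‖ ^ 2 - inner ℝ e f ^ 2) =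
      inner ℝ y e ^ 2 * ‖f‖ ^ 2 + inner ℝ y f ^ 2 * ‖e‖ ^ 2 -
        2 * inner ℝ y e * inner ℝ y f * inner ℝ e f := by
  rw [lcb_normSq_planar hy, lcb_normSq_planar he, lcb_normSq_planar hf, lcb_inner_planar hy,
    lcb_inner_planar hy, lcb_inner_planar he]
  ring

/-- Arithmetic of the registry estimate: the Gram identity with side data in the band and projections
`≤ 4a²/75` forces `‖y‖² ≤ a²/25`. [folklore] -/
theorem lcb_arith_gram {a Y P1 P2 R p1 p2 : ℝ} (ha : 0 < a)
    (hP1 : (a * (1 - 1 / 50)) ^ 2 ≤ P1 ∧ P1 ≤ (a * (1 + 1 / 50)) ^ 2)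
    (hP2 : (a * (1 - 1 / 50)) ^ 2 ≤ P2 ∧ P2 ≤ (a * (1 + 1 / 50)) ^ 2)
    (hR : (a * (1 - 1 / 50)) ^ 2 ≤ R ∧ R ≤ (a * (1 + 1 / 50)) ^ 2)
    (hp1 : |p1| ≤ 4 / 75 * a ^ 2) (hp2 : |p2| ≤ 4 / 75 * a ^ 2) (hY : 0 ≤ Y)
    (hG : Y * (P1 * P2 - ((P1 + P2 - R) / 2) ^ 2) =
      p1 ^ 2 * P2 + p2 ^ 2 * P1 - 2 * p1 * p2 * ((P1 + P2 - R) / 2)) :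
    Y ≤ a ^ 2 / 25 := by
  have hL : (a * (1 - 1 / 50)) ^ 2 = 2401 / 2500 * a ^ 2 := by ring
  have hU : (a * (1 + 1 / 50)) ^ 2 = 2601 / 2500 * a ^ 2 := by ring
  rw [hL, hU] at hP1 hP2 hR
  have ha2 : 0 < a ^ 2 := by positivity
  set c := (P1 + P2 - R) / 2 with hc
  have hc0 : 0 ≤ c := by rw [hc]; linarith
  have hc1 : c ≤ 2801 / 5000 * a ^ 2 := by rw [hc]; linarith
  have hD : 3 / 5 * a ^ 4 ≤ P1 * P2 - c ^ 2 := by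
    have h1 : (2401 / 2500 * a ^ 2) * (2401 / 2500 * a ^ 2) ≤ P1 * P2 :=
      mul_le_mul hP1.1 hP2.1 (by positivity) (by linarith [hP1.1])
    have h2 : c ^ 2 ≤ (2801 / 5000 * a ^ 2) ^ 2 := pow_le_pow_left₀ hc0 hc1 2
    nlinarith
  have hδ : (0 : ℝ) ≤ 4 / 75 * a ^ 2 := by positivity
  have hp1sq : p1 ^ 2 ≤ (4 / 75 * a ^ 2) ^ 2 := by
    rw [← sq_abs]; exact pow_le_pow_left₀ (abs_nonneg _) hp1 2
  have hp2sq : p2 ^ 2 ≤ (4 / 75 * a ^ 2) ^ 2 := by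
    rw [← sq_abs]; exact pow_le_pow_left₀ (abs_nonneg _) hp2 2
  have e1 : p1 ^ 2 * P2 ≤ (4 / 75 * a ^ 2) ^ 2 * (2601 / 2500 * a ^ 2) :=
    mul_le_mul hp1sq hP2.2 (by linarith [hP2.1]) (sq_nonneg _)
  have e2 : p2 ^ 2 * P1 ≤ (4 / 75 * a ^ 2) ^ 2 * (2601 / 2500 * a ^ 2) :=
    mul_le_mul hp2sq hP1.2 (by linarith [hP1.1]) (sq_nonneg _)
  have e3 : -(2 * p1 * p2 * c) ≤ 2 * ((4 / 75 * a ^ 2) * (4 / 75 * a ^ 2)) * (2801 / 5000 * a ^ 2) := by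
    have h1 : |p1 * p2| ≤ (4 / 75 * a ^ 2) * (4 / 75 * a ^ 2) := by
      rw [abs_mul]; exact mul_le_mul hp1 hp2 (abs_nonneg _) hδ
    have h2 := neg_abs_le (p1 * p2)
    have h3 : -(p1 * p2) * c ≤ (4 / 75 * a ^ 2) * (4 / 75 * a ^ 2) * c :=
      mul_le_mul_of_nonneg_right (by linarith) hc0
    have h4 : (4 / 75 * a ^ 2) * (4 / 75 * a ^ 2) * c ≤
        (4 / 75 * a ^ 2) * (4 / 75 * a ^ 2) * (2801 / 5000 * a ^ 2) :=
      mul_le_mul_of_nonneg_left hc1 (by positivity)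
    linarith
  have hR' : Y * (P1 * P2 - c ^ 2) ≤ 8003 / 2500 * a ^ 2 * (4 / 75 * a ^ 2) ^ 2 := by
    rw [hG]; nlinarith
  have h5 : Y * (3 / 5 * a ^ 4) ≤ Y * (P1 * P2 - c ^ 2) := mul_le_mul_of_nonneg_left hD hY
  by_contra hcon
  have hY' : a ^ 2 / 25 < Y := lt_of_not_ge hcon
  have h6 : a ^ 2 / 25 * (3 / 5 * a ^ 4) < Y * (3 / 5 * a ^ 4) :=
    mul_lt_mul_of_pos_right hY' (by positivity)
  nlinarith [pow_pos ha 6]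

/-- **Three-disc lemma.** Let `A, B, C` be planar points with pairwise squared distances in the band
`[(a(1-1/50))², (a(1+1/50))²]` and `x` a planar point whose three squared distances to `A, B, C` lie in a
common window `[lo, hi]` of width `≤ (a(1+1/50))² - (a(1-1/50))²`. Then (i) `hi ≥ (a(1-1/50))²/3` (the mean
squared distance to the vertices is at least a ninth of the sum of the squared sides) and (ii) `x` is within
`a/5` of the centroid: `‖x - (A + B + C)/3‖² ≤ a²/25` (the projections of `x - G` on the two edge directions
`A - B`, `A - C` are `≤ 4a²/75` in absolute value; conclude by the planar Gram identity). [folklore] -/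
theorem lcb_three_disc {a lo hi : ℝ} {x A B C : EuclideanSpace ℝ (Fin 3)} (ha : 0 < a)
    (hx : x 2 = 0) (hA : A 2 = 0) (hB : B 2 = 0) (hC : C 2 = 0)
    (hAB : (a * (1 - 1 / 50)) ^ 2 ≤ ‖A - B‖ ^ 2 ∧ ‖A - B‖ ^ 2 ≤ (a * (1 + 1 / 50)) ^ 2)
    (hAC : (a * (1 - 1 / 50)) ^ 2 ≤ ‖A - C‖ ^ 2 ∧ ‖A - C‖ ^ 2 ≤ (a * (1 + 1 / 50)) ^ 2)
    (hBC : (a * (1 - 1 / 50)) ^ 2 ≤ ‖B - C‖ ^ 2 ∧ ‖B - C‖ ^ 2 ≤ (a * (1 + 1 / 50)) ^ 2)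
    (hxA : lo ≤ ‖x - A‖ ^ 2 ∧ ‖x - A‖ ^ 2 ≤ hi) (hxB : lo ≤ ‖x - B‖ ^ 2 ∧ ‖x - B‖ ^ 2 ≤ hi)
    (hxC : lo ≤ ‖x - C‖ ^ 2 ∧ ‖x - C‖ ^ 2 ≤ hi)
    (hw : hi - lo ≤ (a * (1 + 1 / 50)) ^ 2 - (a * (1 - 1 / 50)) ^ 2) :
    (a * (1 - 1 / 50)) ^ 2 / 3 ≤ hi ∧ ‖x - (1 / 3 : ℝ) • (A + B + C)‖ ^ 2 ≤ a ^ 2 / 25 := by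
  -- the three vertex vectors seen from `x`
  set p := x - A with hp
  set q := x - B with hq
  set r := x - C with hr
  have hpq : p - q = B - A := by rw [hp, hq]; abel
  have hqr : q - r = C - B := by rw [hq, hr]; abel
  have hpr : p - r = C - A := by rw [hp, hr]; abel
  have nAB : ‖p - q‖ ^ 2 = ‖A - B‖ ^ 2 := by rw [hpq, norm_sub_rev]
  have nBC : ‖q - r‖ ^ 2 = ‖B - C‖ ^ 2 := by rw [hqr, norm_sub_rev]
  have nAC : ‖p - r‖ ^ 2 = ‖A - C‖ ^ 2 := by rw [hpr, norm_sub_rev]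
  have nrp : ‖r - p‖ ^ 2 = ‖A - C‖ ^ 2 := by rw [norm_sub_rev, nAC]
  have nrq : ‖r - q‖ ^ 2 = ‖B - C‖ ^ 2 := by rw [norm_sub_rev, nBC]
  have nqp : ‖q - p‖ ^ 2 = ‖A - B‖ ^ 2 := by rw [norm_sub_rev, nAB]
  -- `x - G = (p + q + r)/3`
  have hy : x - (1 / 3 : ℝ) • (A + B + C) = (1 / 3 : ℝ) • (p + q + r) := by
    rw [hp, hq, hr]; module
  constructor
  · -- (i) the mean of the squared distances
    have h0 : 0 ≤ ‖p + q + r‖ ^ 2 := sq_nonneg _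
    rw [lcb_sum_three_identity, nAB, nBC, nAC] at h0
    nlinarith [hxA.2, hxB.2, hxC.2, hAB.1, hBC.1, hAC.1]
  · -- (ii) the registry estimate
    set y := x - (1 / 3 : ℝ) • (A + B + C) with hydef
    have hy2 : y 2 = 0 := by
      rw [hydef]; simp [hx, hA, hB, hC]
    have he2 : (A - B) 2 = 0 := by simp [hA, hB]
    have hf2 : (A - C) 2 = 0 := by simp [hA, hC]
    -- the two projections
    have hAB' : A - B = q - p := by rw [hp, hq]; abel
    have hAC' : A - C = r - p := by rw [hp, hr]; abel
    have hp1 : 6 * inner ℝ y (A - B) = 3 * ‖q‖ ^ 2 - 3 * ‖p‖ ^ 2 + ‖A - C‖ ^ 2 - ‖B - C‖ ^ 2 := by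
      rw [hy, hAB', inner_smul_left, ← nrp, ← nrq, ← lcb_inner_sum_diff p q r]
      simp only [conj_trivial]; ring
    have hp2 : 6 * inner ℝ y (A - C) = 3 * ‖r‖ ^ 2 - 3 * ‖p‖ ^ 2 + ‖A - B‖ ^ 2 - ‖B - C‖ ^ 2 := by
      rw [hy, hAC', inner_smul_left, ← nqp, ← nBC, show p + q + r = p + r + q by abel,
        ← lcb_inner_sum_diff p r q]
      simp only [conj_trivial]; ring
    have hb1 : |inner ℝ y (A - B)| ≤ 4 / 75 * a ^ 2 := by
      rw [abs_le]; constructor <;> linarith [hxA.1, hxA.2, hxB.1, hxB.2, hAC.1, hAC.2, hBC.1, hBC.2]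
    have hb2 : |inner ℝ y (A - C)| ≤ 4 / 75 * a ^ 2 := by
      rw [abs_le]; constructor <;> linarith [hxA.1, hxA.2, hxC.1, hxC.2, hAB.1, hAB.2, hBC.1, hBC.2]
    -- the Gram identity
    have hG := lcb_gram_identity hy2 he2 hf2
    have hef : inner ℝ (A - B) (A - C) = (‖A - B‖ ^ 2 + ‖A - C‖ ^ 2 - ‖B - C‖ ^ 2) / 2 := by
      have h := norm_sub_sq_real (A - B) (A - C)
      rw [show A - B - (A - C) = C - B by abel, norm_sub_rev C B] at h
      linarith
    rw [hef] at hG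
    exact lcb_arith_gram ha hAB hAC hBC hb1 hb2 (sq_nonneg _) hG

/-! ## Sites of a laminar set, at the level of indices -/

/-- The pre-image site `t = (m, i, j)` of a laminar set: `i u + j v + w m + z m • e₃` (the set itself is
`v₀ + A (range lcbPt)`). [folklore] -/
def lcbPt (u v : EuclideanSpace ℝ (Fin 3)) (w : ℤ → EuclideanSpace ℝ (Fin 3)) (z : ℤ → ℝ)
    (t : ℤ × ℤ × ℤ) : EuclideanSpace ℝ (Fin 3) :=
  (t.2.1 : ℝ) • u + (t.2.2 : ℝ) • v + w t.1 + z t.1 • layerNormal 1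

/-- The horizontal offset from site `t` to site `t'`: `(i' - i) u + (j' - j) v + (w m' - w m)`. [folklore] -/
def lcbOff (u v : EuclideanSpace ℝ (Fin 3)) (w : ℤ → EuclideanSpace ℝ (Fin 3)) (t t' : ℤ × ℤ × ℤ) :
    EuclideanSpace ℝ (Fin 3) :=
  ((t'.2.1 - t.2.1 : ℤ) : ℝ) • u + ((t'.2.2 - t.2.2 : ℤ) : ℝ) • v + (w t'.1 - w t.1)

/-- Site differences split into horizontal offset and vertical part. [folklore] -/
theorem lcb_pt_sub (u v : EuclideanSpace ℝ (Fin 3)) (w : ℤ → EuclideanSpace ℝ (Fin 3)) (z : ℤ → ℝ)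
    (t t' : ℤ × ℤ × ℤ) :
    lcbPt u v w z t' - lcbPt u v w z t = lcbOff u v w t t' + (z t'.1 - z t.1) • layerNormal 1 := by
  simp only [lcbPt, lcbOff]
  push_cast
  module

/-- Horizontal offsets are planar. [folklore] -/
theorem lcbOff_two {u v : EuclideanSpace ℝ (Fin 3)} {w : ℤ → EuclideanSpace ℝ (Fin 3)}
    (hu2 : u 2 = 0) (hv2 : v 2 = 0) (hw2 : ∀ m : ℤ, w m 2 = 0) (t t' : ℤ × ℤ × ℤ) :
    lcbOff u v w t t' 2 = 0 := by
  simp [lcbOff, hu2, hv2, hw2]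

/-- The vertical coordinate of a site is its height. [folklore] -/
theorem lcbPt_two {u v : EuclideanSpace ℝ (Fin 3)} {w : ℤ → EuclideanSpace ℝ (Fin 3)}
    (hu2 : u 2 = 0) (hv2 : v 2 = 0) (hw2 : ∀ m : ℤ, w m 2 = 0) (z : ℤ → ℝ) (t : ℤ × ℤ × ℤ) :
    lcbPt u v w z t 2 = z t.1 := by
  simp [lcbPt, hu2, hv2, hw2, layerNormal]

/-- **Squared distance of two sites** `= ‖horizontal offset‖² + (height difference)²`. [folklore] -/
theorem lcb_distSq {u v : EuclideanSpace ℝ (Fin 3)} {w : ℤ → EuclideanSpace ℝ (Fin 3)}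
    (hu2 : u 2 = 0) (hv2 : v 2 = 0) (hw2 : ∀ m : ℤ, w m 2 = 0) (z : ℤ → ℝ) (t t' : ℤ × ℤ × ℤ) :
    dist (lcbPt u v w z t) (lcbPt u v w z t') ^ 2 = ‖lcbOff u v w t t'‖ ^ 2 + (z t'.1 - z t.1) ^ 2 := by
  rw [dist_comm, dist_eq_norm, lcb_pt_sub, lcb_pyth (lcbOff_two hu2 hv2 hw2 t t')]

/-- In one layer the horizontal offset is the lattice vector of the index difference. [folklore] -/
theorem lcbOff_sameLayer (u v : EuclideanSpace ℝ (Fin 3)) (w : ℤ → EuclideanSpace ℝ (Fin 3))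
    {t t' : ℤ × ℤ × ℤ} (h : t.1 = t'.1) :
    lcbOff u v w t t' = ((t'.2.1 - t.2.1 : ℤ) : ℝ) • u + ((t'.2.2 - t.2.2 : ℤ) : ℝ) • v := by
  simp [lcbOff, h]

/-- **The site map is injective** (non-degenerate lattice, strictly increasing heights). [folklore] -/
theorem lcb_pt_injective {a : ℝ} {u v : EuclideanSpace ℝ (Fin 3)} {w : ℤ → EuclideanSpace ℝ (Fin 3)}
    {z : ℤ → ℝ} (ha : 0 < a)
    (hu : a * (1 - 1 / 50) ≤ ‖u‖ ∧ ‖u‖ ≤ a * (1 + 1 / 50))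
    (hv : a * (1 - 1 / 50) ≤ ‖v‖ ∧ ‖v‖ ≤ a * (1 + 1 / 50))
    (huv : a * (1 - 1 / 50) ≤ ‖u - v‖ ∧ ‖u - v‖ ≤ a * (1 + 1 / 50))
    (hu2 : u 2 = 0) (hv2 : v 2 = 0) (hw2 : ∀ m : ℤ, w m 2 = 0) (hz : StrictMono z) :
    Function.Injective (lcbPt u v w z) := by
  intro t t' h
  have hd : dist (lcbPt u v w z t) (lcbPt u v w z t') ^ 2 = 0 := by rw [h, dist_self]; ring
  rw [lcb_distSq hu2 hv2 hw2] at hd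
  have hB : (z t'.1 - z t.1) ^ 2 = 0 := by
    linarith [sq_nonneg ‖lcbOff u v w t t'‖, sq_nonneg (z t'.1 - z t.1)]
  have hm : t.1 = t'.1 := hz.injective (by nlinarith [pow_eq_zero_iff (two_ne_zero) |>.1 hB])
  have hA : ‖lcbOff u v w t t'‖ ^ 2 = 0 := by linarith [sq_nonneg ‖lcbOff u v w t t'‖]
  rw [lcbOff_sameLayer u v w hm] at hA
  by_contra hne
  have hidx : (t'.2.1 - t.2.1, t'.2.2 - t.2.2) ≠ ((0 : ℤ), (0 : ℤ)) := by
    intro h0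
    simp only [Prod.mk.injEq] at h0
    exact hne (Prod.ext hm (Prod.ext (by omega) (by omega)))
  have := lcb_lat_ne_zero ha hu hv huv hidx
  nlinarith [pow_pos ha 2]

/-! ## From the set to the indices -/

/-- Membership in a laminar set: its points are the images `A (lcbPt t) + v₀` of the sites. [folklore] -/
theorem lcb_mem_iff {A : EuclideanSpace ℝ (Fin 3) →ₗᵢ[ℝ] EuclideanSpace ℝ (Fin 3)}
    {u v v₀ : EuclideanSpace ℝ (Fin 3)} {w : ℤ → EuclideanSpace ℝ (Fin 3)} {z : ℤ → ℝ}
    {Z : Set (EuclideanSpace ℝ (Fin 3))}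
    (hZ : Z = (fun p => p + v₀) '' {p : EuclideanSpace ℝ (Fin 3) | ∃ m i j : ℤ,
        p = A (((i : ℝ) • u) + ((j : ℝ) • v) + w m + (z m • layerNormal 1))})
    {x : EuclideanSpace ℝ (Fin 3)} : x ∈ Z ↔ ∃ t : ℤ × ℤ × ℤ, x = A (lcbPt u v w z t) + v₀ := by
  subst hZ
  constructor
  · rintro ⟨p, ⟨m, i, j, rfl⟩, rfl⟩
    exact ⟨(m, i, j), rfl⟩
  · rintro ⟨⟨m, i, j⟩, rfl⟩
    exact ⟨_, ⟨m, i, j, rfl⟩, rfl⟩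

/-- Distances in the set are distances of sites. [folklore] -/
theorem lcb_dist_site (A : EuclideanSpace ℝ (Fin 3) →ₗᵢ[ℝ] EuclideanSpace ℝ (Fin 3))
    (u v v₀ : EuclideanSpace ℝ (Fin 3)) (w : ℤ → EuclideanSpace ℝ (Fin 3)) (z : ℤ → ℝ) (t t' : ℤ × ℤ × ℤ) :
    dist (A (lcbPt u v w z t) + v₀) (A (lcbPt u v w z t') + v₀) = dist (lcbPt u v w z t) (lcbPt u v w z t') := by
  rw [dist_add_right, LinearIsometry.dist_map]

/-- The bond shell of the point of index `t₀` is the image of the index shell. [folklore] -/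
theorem lcb_shell_eq_image {A : EuclideanSpace ℝ (Fin 3) →ₗᵢ[ℝ] EuclideanSpace ℝ (Fin 3)}
    {u v v₀ : EuclideanSpace ℝ (Fin 3)} {w : ℤ → EuclideanSpace ℝ (Fin 3)} {z : ℤ → ℝ}
    {Z : Set (EuclideanSpace ℝ (Fin 3))}
    (hZ : Z = (fun p => p + v₀) '' {p : EuclideanSpace ℝ (Fin 3) | ∃ m i j : ℤ,
        p = A (((i : ℝ) • u) + ((j : ℝ) • v) + w m + (z m • layerNormal 1))})
    (hinj : Function.Injective (lcbPt u v w z)) (t₀ : ℤ × ℤ × ℤ) (r : ℝ) :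
    {x ∈ Z | x ≠ A (lcbPt u v w z t₀) + v₀ ∧ dist (A (lcbPt u v w z t₀) + v₀) x ≤ r} =
      (fun t => A (lcbPt u v w z t) + v₀) '' {t | t ≠ t₀ ∧ dist (lcbPt u v w z t₀) (lcbPt u v w z t) ≤ r} := by
  ext x
  simp only [Set.mem_setOf_eq, Set.mem_image]
  constructor
  · rintro ⟨hx, hne, hd⟩
    obtain ⟨t, rfl⟩ := (lcb_mem_iff hZ).1 hx
    refine ⟨t, ⟨fun h => hne (by rw [h]), ?_⟩, rfl⟩
    rwa [lcb_dist_site] at hd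
  · rintro ⟨t, ⟨hne, hd⟩, rfl⟩
    refine ⟨(lcb_mem_iff hZ).2 ⟨t, rfl⟩, fun h => hne (hinj (A.injective (add_right_cancel h))), ?_⟩
    rwa [lcb_dist_site]

/-- **The count on indices**: every index has exactly twelve other indices within `a(1 + 1/50)`. [folklore] -/
theorem lcb_countI {A : EuclideanSpace ℝ (Fin 3) →ₗᵢ[ℝ] EuclideanSpace ℝ (Fin 3)}
    {u v v₀ : EuclideanSpace ℝ (Fin 3)} {w : ℤ → EuclideanSpace ℝ (Fin 3)} {z : ℤ → ℝ}
    {Z : Set (EuclideanSpace ℝ (Fin 3))} {a : ℝ}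
    (hZ : Z = (fun p => p + v₀) '' {p : EuclideanSpace ℝ (Fin 3) | ∃ m i j : ℤ,
        p = A (((i : ℝ) • u) + ((j : ℝ) • v) + w m + (z m • layerNormal 1))})
    (hinj : Function.Injective (lcbPt u v w z))
    (hcount : ∀ y ∈ Z, {x ∈ Z | x ≠ y ∧ dist y x ≤ a * (1 + 1 / 50)}.ncard = 12) (t₀ : ℤ × ℤ × ℤ) :
    {t : ℤ × ℤ × ℤ | t ≠ t₀ ∧ dist (lcbPt u v w z t₀) (lcbPt u v w z t) ≤ a * (1 + 1 / 50)}.ncard = 12 := by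
  have h := hcount _ ((lcb_mem_iff hZ).2 ⟨t₀, rfl⟩)
  have hinj' : Function.Injective (fun t => A (lcbPt u v w z t) + v₀) :=
    fun t t' h => hinj (A.injective (add_right_cancel h))
  rwa [lcb_shell_eq_image hZ hinj, Set.ncard_image_of_injective _ hinj'] at h

/-- **The gap clause on indices.** [folklore] -/
theorem lcb_gapI {A : EuclideanSpace ℝ (Fin 3) →ₗᵢ[ℝ] EuclideanSpace ℝ (Fin 3)}
    {u v v₀ : EuclideanSpace ℝ (Fin 3)} {w : ℤ → EuclideanSpace ℝ (Fin 3)} {z : ℤ → ℝ}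
    {Z : Set (EuclideanSpace ℝ (Fin 3))} {a : ℝ}
    (hZ : Z = (fun p => p + v₀) '' {p : EuclideanSpace ℝ (Fin 3) | ∃ m i j : ℤ,
        p = A (((i : ℝ) • u) + ((j : ℝ) • v) + w m + (z m • layerNormal 1))})
    (hinj : Function.Injective (lcbPt u v w z))
    (hgap : ∀ y ∈ Z, ∀ x ∈ Z, x ≠ y → a * (1 - 1 / 50) ≤ dist y x ∧
      (dist y x ≤ a * (1 + 1 / 50) ∨ a * (63 / 50) ≤ dist y x))
    {t t' : ℤ × ℤ × ℤ} (hne : t ≠ t') :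
    a * (1 - 1 / 50) ≤ dist (lcbPt u v w z t) (lcbPt u v w z t') ∧
      (dist (lcbPt u v w z t) (lcbPt u v w z t') ≤ a * (1 + 1 / 50) ∨
        a * (63 / 50) ≤ dist (lcbPt u v w z t) (lcbPt u v w z t')) := by
  have h := hgap _ ((lcb_mem_iff hZ).2 ⟨t, rfl⟩) _ ((lcb_mem_iff hZ).2 ⟨t', rfl⟩)
    fun h => hne (hinj (A.injective (add_right_cancel h))).symm
  rwa [lcb_dist_site] at h

/-! ## Heights: the lower bound and the far layers -/

/-- **Consecutive layers are `≥ √(1501/2500) a` apart**: the next layer has a point within squared horizontal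
distance `9a²/25` of the point straight above any site (covering bound), and distinct points are
`≥ a(1 - 1/50)` apart. [folklore] -/
theorem lcb_height_sq_lower {a : ℝ} {u v : EuclideanSpace ℝ (Fin 3)} {w : ℤ → EuclideanSpace ℝ (Fin 3)}
    {z : ℤ → ℝ} (ha : 0 < a)
    (hu : a * (1 - 1 / 50) ≤ ‖u‖ ∧ ‖u‖ ≤ a * (1 + 1 / 50))
    (hv : a * (1 - 1 / 50) ≤ ‖v‖ ∧ ‖v‖ ≤ a * (1 + 1 / 50))
    (huv : a * (1 - 1 / 50) ≤ ‖u - v‖ ∧ ‖u - v‖ ≤ a * (1 + 1 / 50))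
    (hu2 : u 2 = 0) (hv2 : v 2 = 0) (hw2 : ∀ m : ℤ, w m 2 = 0)
    (hgapI : ∀ t t' : ℤ × ℤ × ℤ, t ≠ t' → a * (1 - 1 / 50) ≤ dist (lcbPt u v w z t) (lcbPt u v w z t'))
    (m : ℤ) : 1501 / 2500 * a ^ 2 ≤ (z (m + 1) - z m) ^ 2 := by
  obtain ⟨i, j, hij⟩ := lcb_cover ha hu hv huv hu2 hv2 (x := w (m + 1) - w m) (by simp [hw2])
  have hne : ((m + 1, 0, 0) : ℤ × ℤ × ℤ) ≠ (m, i, j) := by simp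
  have h := hgapI _ _ hne
  have hsq := pow_le_pow_left₀ (by positivity) h 2
  rw [lcb_distSq hu2 hv2 hw2] at hsq
  have e : ‖lcbOff u v w (m + 1, 0, 0) (m, i, j)‖ = ‖w (m + 1) - w m - ((i : ℝ) • u + (j : ℝ) • v)‖ := by
    rw [← norm_neg]
    congr 1
    simp only [lcbOff, sub_zero]
    abel
  rw [e] at hsq
  have e2 : (z ((m, i, j) : ℤ × ℤ × ℤ).1 - z ((m + 1, 0, 0) : ℤ × ℤ × ℤ).1) ^ 2 = (z (m + 1) - z m) ^ 2 := by
    simp only; ring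
  rw [e2] at hsq
  nlinarith

/-- The lower height bound in linear form: `z (m+1) - z m ≥ 3a/4`. [folklore] -/
theorem lcb_height_lower {a : ℝ} {z : ℤ → ℝ} (ha : 0 < a) (hz : ∀ m : ℤ, z m < z (m + 1)) {m : ℤ}
    (h : 1501 / 2500 * a ^ 2 ≤ (z (m + 1) - z m) ^ 2) : 3 / 4 * a ≤ z (m + 1) - z m := by
  have h0 : 0 < z (m + 1) - z m := sub_pos.2 (hz m)
  nlinarith [sq_nonneg (z (m + 1) - z m + 3 / 4 * a)]

/-- **Far layers are out of reach**: two or more layers away the height difference alone exceeds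
`a(1 + 1/50)`. [folklore] -/
theorem lcb_far {a : ℝ} {z : ℤ → ℝ} (ha : 0 < a) (hzm : StrictMono z)
    (hincr : ∀ k : ℤ, 3 / 4 * a ≤ z (k + 1) - z k) {m m' : ℤ} (h2 : m + 2 ≤ m' ∨ m' + 2 ≤ m) :
    (a * (1 + 1 / 50)) ^ 2 < (z m' - z m) ^ 2 := by
  rcases h2 with h2 | h2
  · have e1 := hincr m
    have e2 := hincr (m + 1)
    have e3 : z (m + 1 + 1) ≤ z m' := hzm.monotone (by omega)
    nlinarith
  · have e1 := hincr m'
    have e2 := hincr (m' + 1)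
    have e3 : z (m' + 1 + 1) ≤ z m := hzm.monotone (by omega)
    nlinarith

/-- The index shell of `t₀`: indices `t ≠ t₀` whose site is within `a(1 + 1/50)` of the site of `t₀`.
[folklore] -/
def lcbS (a : ℝ) (u v : EuclideanSpace ℝ (Fin 3)) (w : ℤ → EuclideanSpace ℝ (Fin 3)) (z : ℤ → ℝ)
    (t₀ : ℤ × ℤ × ℤ) : Set (ℤ × ℤ × ℤ) :=
  {t | t ≠ t₀ ∧ dist (lcbPt u v w z t₀) (lcbPt u v w z t) ≤ a * (1 + 1 / 50)}

end Summit.AtomisticToContinuum.Crystallization.Theorems.CleanHull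

end
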